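import Summits.BirchSwinnertonDyer.BirchSwinnertonDyer.Theorems.TwoAdicConverseModFourTraceOneTwoTorsionPoint
import Mathlib.NumberTheory.LegendreSymbol.Basic
import HarnessLib

/-!
# Route `TwoAdicConverse` (rung S3), crux `OrdLambdaHalfAtTwo` (item 19556), card `mod-four-redei-layer-two` — lemma K0 in
# LEGENDRE-SYMBOL form: `2a_ℓ ≡ 2ℓ + 1 + (B/ℓ) + (Δ/ℓ) − (BΔ/ℓ) (mod 8)`, and the newform-coefficient reading

Cell `bsd-2adic`, seat `bsd-2adic-conv-1` (GEN 21). THEOREMS ONLY — no named fact, no definition, nothing conditional. Sequel of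
`TwoAdicConverseModFourTraceOneTwoTorsionPoint` (K0: `4 ∣ ℓ + 1 − a_ℓ ⟺ (B/ℓ) = 1 ∨ (Δ/ℓ) = 1`). The card's lever reads the
mod-`4` Hecke eigensystem of a curve with ONE rational point of order `2` as «`a_ℓ ≡ ℓ + 1 − 2·e_B(ℓ)·e_d(ℓ) (mod 4)` … the
product `e_B·e_d` is the Frobenius shadow of the cup product `χ_B ∪ χ_d`»; here that is made a CLOSED FORMULA in Mathlib's
`legendreSym`, the currency a Stickelberger-type comparison (the card's K2/K3, NOT touched here) would consume:

* `not_dvd_twoIsogenyDiscrClass_of_hasRationalTwoTorsionX` — `ℓ ∤ B = 3m² + 2b₂m + 8b₄` at an odd good prime (`B/16` is the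
  `b`-coefficient of the elliptic normal form `y² = x³ + ax² + bx` of `W̃/𝔽_ℓ`), so `(B/ℓ), (Δ/ℓ) ∈ {±1}`;
* `two_mul_frobeniusTrace_modEq_eight_of_hasRationalTwoTorsionX` — **`2·a_ℓ ≡ 2ℓ + 1 + (B/ℓ) + (Δ/ℓ) − (BΔ/ℓ) (mod 8)`**,
  i.e. `a_ℓ ≡ ℓ + ε(ℓ) (mod 4)` with `ε = (1 + χ_B + χ_Δ − χ_Bχ_Δ)/2 ∈ {±1}` (`= −1` exactly at the doubly-inert primes);
* `frobeniusTrace_modEq_four_of_hasRationalTwoTorsionX` — the same as `a_ℓ ≡ ℓ + 1 − (1 − (B/ℓ))(1 − (Δ/ℓ))/2 (mod 4)`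
  (the card's `ℓ + 1 − 2·e_B·e_Δ`, `e_c = (1 − (c/ℓ))/2`);
* `exists_cuspCoeff_eq_of_hasRationalTwoTorsionX` — for any newform `f` of `W` (`IsNewformOf W f`):
  `a_ℓ(f) = ℓ + ε(ℓ) + 4j`, `j ∈ ℤ` — the mod-`4` eigensystem on the good Hecke operators `T_ℓ`, `ℓ ∤ 2N`.

HONEST FRAMING: elementary consequences of K0; nothing about `λ`-invariants, modular symbols or BSD is claimed; items 19556 / 19218
stay OPEN; BSD is not proved by any of this. PARTITION (D-0054): none — RANK axis (S3).

References: A. W. Knapp, *Elliptic Curves* (1992), Thm. 4.2 [Knapp1993]; J. H. Silverman, *AEC* (2009), X.4.9, V.2.3.1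
[SilvermanAEC2009]; B. Mazur, Publ. IHÉS 47 (1977), II.§9, II.§14 (the Eisenstein prime `2`) [Mazur1977].
-/

set_option linter.dupNamespace false
set_option autoImplicit false

noncomputable section

open scoped Classical
open WeierstrassCurve Literature.NumberTheory.EllipticCurves Literature.NumberTheory.EllipticCurves.Greenberg1999
  Literature.NumberTheory.EllipticCurves.ModularForms

namespace Summit.BirchSwinnertonDyer.BirchSwinnertonDyer.Theorems.TwoAdicTwistConverse

variable (W : WeierstrassCurve ℚ) [W.IsElliptic] [W.IsGloballyMinimal] (ℓ : ℕ) [Fact ℓ.Prime]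

omit [W.IsElliptic] in
/-- **`ℓ ∤ B`**: at an odd good prime `ℓ` of a globally minimal `W/ℚ` with a rational point of order `2` (abscissa `x`,
`m = 4x`), the integer `B = 3m² + 2b₂m + 8b₄` (square class of the discriminant of `E/⟨P⟩`) is prime to `ℓ` — it is `16b` for
the ELLIPTIC normal form `y² = x³ + ax² + bx` of the reduction. [cite: SilvermanAEC2009, X.4.9 (b ≠ 0)] -/
theorem not_dvd_twoIsogenyDiscrClass_of_hasRationalTwoTorsionX (hℓ : ℓ ≠ 2) (hgood : W.HasGoodReductionAtPrime ℓ)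
    {x : ℚ} (hx : HasRationalTwoTorsionX W x) {m : ℤ} (hm : (m : ℚ) = 4 * x) :
    ¬ (ℓ : ℤ) ∣ 3 * m ^ 2 + 2 * (integralModelInt W).b₂ * m + 8 * (integralModelInt W).b₄ := by
  obtain ⟨V, hNF, hVE, -, hb, -, -⟩ := exists_twoTorsionNF_reduction W ℓ hℓ hgood hx hm
  rw [← ZMod.intCast_zmod_eq_zero_iff_dvd, ← hb]
  have h16 : (16 : ZMod ℓ) ≠ 0 := by
    rw [show (16 : ZMod ℓ) = 2 ^ 4 by norm_num]; exact pow_ne_zero _ (two_ne_zero' V)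
  exact mul_ne_zero h16 (a₄_ne_zero V)

/-- **K0 in Legendre symbols: `2·a_ℓ ≡ 2ℓ + 1 + (B/ℓ) + (Δ/ℓ) − (BΔ/ℓ) (mod 8)`** for a globally minimal `W/ℚ` with ONE
rational point of order `2` (abscissa `x`, `m = 4x`, `B = 3m² + 2b₂m + 8b₄`, `Δ` the minimal discriminant) at every odd good
prime `ℓ`. Equivalently `a_ℓ ≡ ℓ + ε(ℓ) (mod 4)` with `ε = (1 + χ_B + χ_Δ − χ_Bχ_Δ)/2`, which is `+1` unless `B` and `Δ`
are both non-residues mod `ℓ`, when it is `−1`. (Case check of K0: `a_ℓ ≡ ℓ + 1` if `(B/ℓ) = 1` or `(Δ/ℓ) = 1`, else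
`a_ℓ ≡ ℓ − 1`.) [cite: Knapp1993, Thm. 4.2] [cite: SilvermanAEC2009, X.4.9 and V.2.3.1] -/
theorem two_mul_frobeniusTrace_modEq_eight_of_hasRationalTwoTorsionX (hℓ : ℓ ≠ 2)
    (hgood : W.HasGoodReductionAtPrime ℓ) {x : ℚ} (hx : HasRationalTwoTorsionX W x) {m : ℤ}
    (hm : (m : ℚ) = 4 * x) :
    2 * W.frobeniusTrace ℓ ≡ 2 * ℓ + 1 +
      legendreSym ℓ (3 * m ^ 2 + 2 * (integralModelInt W).b₂ * m + 8 * (integralModelInt W).b₄) +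
      legendreSym ℓ (minimalDiscriminantInt W) -
      legendreSym ℓ ((3 * m ^ 2 + 2 * (integralModelInt W).b₂ * m + 8 * (integralModelInt W).b₄) *
        minimalDiscriminantInt W) [ZMOD 8] := by
  set B : ℤ := 3 * m ^ 2 + 2 * (integralModelInt W).b₂ * m + 8 * (integralModelInt W).b₄ with hB
  have hB0 : (B : ZMod ℓ) ≠ 0 := by
    rw [Ne, ZMod.intCast_zmod_eq_zero_iff_dvd]
    exact not_dvd_twoIsogenyDiscrClass_of_hasRationalTwoTorsionX W ℓ hℓ hgood hx hm
  have hΔ0 : (minimalDiscriminantInt W : ZMod ℓ) ≠ 0 := by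
    rw [Ne, ZMod.intCast_zmod_eq_zero_iff_dvd]
    exact not_dvd_minimalDiscriminantInt_of_hasGoodReductionAtPrime' W ℓ hgood
  rw [legendreSym.mul]
  have hK0 := four_dvd_succ_sub_frobeniusTrace_iff_of_hasRationalTwoTorsionX W ℓ hℓ hgood hx hm
  rw [← hB] at hK0
  rw [Int.modEq_iff_dvd]
  rcases legendreSym.eq_one_or_neg_one ℓ hB0 with hsB | hsB <;>
    rcases legendreSym.eq_one_or_neg_one ℓ hΔ0 with hsΔ | hsΔ <;> rw [hsB, hsΔ]
  · obtain ⟨j, hj⟩ := hK0.mpr (Or.inl ((legendreSym.eq_one_iff ℓ hB0).mp hsB))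
    exact ⟨j, by linear_combination 2 * hj⟩
  · obtain ⟨j, hj⟩ := hK0.mpr (Or.inl ((legendreSym.eq_one_iff ℓ hB0).mp hsB))
    exact ⟨j, by linear_combination 2 * hj⟩
  · obtain ⟨j, hj⟩ := hK0.mpr (Or.inr ((legendreSym.eq_one_iff ℓ hΔ0).mp hsΔ))
    exact ⟨j, by linear_combination 2 * hj⟩
  · obtain ⟨j, hj⟩ := four_dvd_pred_sub_frobeniusTrace_of_not_isSquare W ℓ hℓ hgood hx hm
      ((legendreSym.eq_neg_one_iff ℓ).mp hsB) ((legendreSym.eq_neg_one_iff ℓ).mp hsΔ)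
    exact ⟨j, by linear_combination 2 * hj⟩

/-- **The card's wording: `a_ℓ ≡ ℓ + 1 − 2·e_B(ℓ)·e_Δ(ℓ) (mod 4)`** with `e_c(ℓ) = [c is a non-residue mod ℓ] =
(1 − (c/ℓ))/2`, i.e. `4 ∣ ℓ + 1 − (1 − (B/ℓ))·(1 − (Δ/ℓ))/2 − a_ℓ` (the integer division is exact: the product is `0` or
`4`). [cite: Knapp1993, Thm. 4.2] -/
theorem frobeniusTrace_modEq_four_of_hasRationalTwoTorsionX (hℓ : ℓ ≠ 2)
    (hgood : W.HasGoodReductionAtPrime ℓ) {x : ℚ} (hx : HasRationalTwoTorsionX W x) {m : ℤ}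
    (hm : (m : ℚ) = 4 * x) :
    W.frobeniusTrace ℓ ≡ ℓ + 1 -
      (1 - legendreSym ℓ (3 * m ^ 2 + 2 * (integralModelInt W).b₂ * m + 8 * (integralModelInt W).b₄)) *
        (1 - legendreSym ℓ (minimalDiscriminantInt W)) / 2 [ZMOD 4] := by
  set B : ℤ := 3 * m ^ 2 + 2 * (integralModelInt W).b₂ * m + 8 * (integralModelInt W).b₄ with hB
  have hB0 : (B : ZMod ℓ) ≠ 0 := by
    rw [Ne, ZMod.intCast_zmod_eq_zero_iff_dvd]
    exact not_dvd_twoIsogenyDiscrClass_of_hasRationalTwoTorsionX W ℓ hℓ hgood hx hm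
  have hΔ0 : (minimalDiscriminantInt W : ZMod ℓ) ≠ 0 := by
    rw [Ne, ZMod.intCast_zmod_eq_zero_iff_dvd]
    exact not_dvd_minimalDiscriminantInt_of_hasGoodReductionAtPrime' W ℓ hgood
  have h8 := two_mul_frobeniusTrace_modEq_eight_of_hasRationalTwoTorsionX W ℓ hℓ hgood hx hm
  rw [← hB, legendreSym.mul] at h8
  obtain ⟨k, hk⟩ := Int.modEq_iff_dvd.mp h8
  rw [Int.modEq_iff_dvd]
  rcases legendreSym.eq_one_or_neg_one ℓ hB0 with hsB | hsB <;>
    rcases legendreSym.eq_one_or_neg_one ℓ hΔ0 with hsΔ | hsΔ <;> rw [hsB, hsΔ] at hk ⊢ <;> norm_num at hk ⊢ <;>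
    exact ⟨k, by omega⟩

/-- **The mod-`4` Hecke eigensystem of the newform**: for any newform `f` attached to `W` (`IsNewformOf W f`: `a_n(f) = a_n(E)`),
its `ℓ`-th Fourier coefficient at an odd good prime is `a_ℓ(f) = ℓ + ε(ℓ) + 4j` for some `j ∈ ℤ`, where
`2ε(ℓ) = 1 + (B/ℓ) + (Δ/ℓ) − (BΔ/ℓ)` (`ε(ℓ) = ±1`) — the input shape of a Stickelberger-type comparison at `2` (card K2/K3,
not formalised). [cite: Knapp1993, Thm. 4.2] [cite: SilvermanAEC2009, V.2.3.1 and Exercise 8.19(a)] -/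
theorem exists_cuspCoeff_eq_of_hasRationalTwoTorsionX {N : ℕ} [NeZero N] {f : CuspForm (CongruenceSubgroup.Gamma0 N) 2}
    (hf : IsNewformOf W f) (hℓ : ℓ ≠ 2) (hgood : W.HasGoodReductionAtPrime ℓ) {x : ℚ}
    (hx : HasRationalTwoTorsionX W x) {m : ℤ} (hm : (m : ℚ) = 4 * x) :
    ∃ j : ℤ, cuspCoeff f ℓ = (((ℓ : ℤ) +
      (1 + legendreSym ℓ (3 * m ^ 2 + 2 * (integralModelInt W).b₂ * m + 8 * (integralModelInt W).b₄) +
        legendreSym ℓ (minimalDiscriminantInt W) -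
        legendreSym ℓ ((3 * m ^ 2 + 2 * (integralModelInt W).b₂ * m + 8 * (integralModelInt W).b₄) *
          minimalDiscriminantInt W)) / 2 + 4 * j : ℤ) : ℂ) := by
  set B : ℤ := 3 * m ^ 2 + 2 * (integralModelInt W).b₂ * m + 8 * (integralModelInt W).b₄ with hB
  have hB0 : (B : ZMod ℓ) ≠ 0 := by
    rw [Ne, ZMod.intCast_zmod_eq_zero_iff_dvd]
    exact not_dvd_twoIsogenyDiscrClass_of_hasRationalTwoTorsionX W ℓ hℓ hgood hx hm
  have hΔ0 : (minimalDiscriminantInt W : ZMod ℓ) ≠ 0 := by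
    rw [Ne, ZMod.intCast_zmod_eq_zero_iff_dvd]
    exact not_dvd_minimalDiscriminantInt_of_hasGoodReductionAtPrime' W ℓ hgood
  have h8 := two_mul_frobeniusTrace_modEq_eight_of_hasRationalTwoTorsionX W ℓ hℓ hgood hx hm
  rw [← hB, legendreSym.mul] at h8
  obtain ⟨k, hk⟩ := Int.modEq_iff_dvd.mp h8
  have hint : ∃ j : ℤ, W.frobeniusTrace ℓ = (ℓ : ℤ) + (1 + legendreSym ℓ B +
      legendreSym ℓ (minimalDiscriminantInt W) - legendreSym ℓ B * legendreSym ℓ (minimalDiscriminantInt W)) / 2 +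
      4 * j := by
    rcases legendreSym.eq_one_or_neg_one ℓ hB0 with hsB | hsB <;>
      rcases legendreSym.eq_one_or_neg_one ℓ hΔ0 with hsΔ | hsΔ <;> rw [hsB, hsΔ] at hk ⊢ <;> norm_num at hk ⊢ <;>
      exact ⟨-k, by omega⟩
  obtain ⟨j, hj⟩ := hint
  refine ⟨j, ?_⟩
  rw [hf.2 ℓ, W.LFunction_apply_prime_eq_frobeniusTrace ℓ hgood, hj, legendreSym.mul]

end Summit.BirchSwinnertonDyer.BirchSwinnertonDyer.Theorems.TwoAdicTwistConverse

end
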